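import Summits.FinalStateConjecture.FinalStateConjecture.Theorems.EIHFluxBalanceInertialRecessionRechartCarterTimeRaising
import Summits.FinalStateConjecture.FinalStateConjecture.Theorems.EIHFluxBalanceInertialRecessionRechartLagBackground
import Summits.FinalStateConjecture.FinalStateConjecture.Theorems.EIHFluxBalanceInertialRecessionStubRechart11Orient
import Summits.FinalStateConjecture.FinalStateConjecture.Theorems.EIHFluxBalanceInertialRecessionStubRechart3HoleLimit
import Literature.Geometry.Lorentzian.KerrDeSitterData

/-!
# Route EIHFluxBalance — `InertialRecession` (E′), re-charting on the given region: the
# ORIENTATION clause (ii) of `IsFutureOriented` for the lagged clock charts of rotating holes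

Helper file for the crux `stmt-FinalStateConjecture-17403`
(`Summit.FinalStateConjecture.FinalStateConjecture.Theses.EIHFluxBalance.InertialRecession`, E′),
line `SketchCleanExcision`, stub `stub_rechartOnRegion` (P2′).

Clause (ii) of `Summit.FinalStateConjecture.IsFutureOriented` asks that, eventually in the chart
time, the push-forward under the hole chart of the boosted Kerr–Schild time vector
`Λ V_{M,a}(Λ⁻¹(y − c))`, `V = −g♯_{M,a}(dt*) = (1 + 2H, −2H ℓ⃗)`, be future-directed on every
truncated slab. For the clock charts of …StubRechart3Package (`A = honestChart Λ̃ ξ T₀` near late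
points of bounded offset) composed with the final boost `Λ` and a lag `c = s Λ e₀`, this follows from
(Ofut) of the lab chart and `C⁰` closeness (`isFutureDirected_mfderiv_comp_of_deviation`,
…RechartKO) once the chart RAISES LAB TIME along `V`: `(DA · V)⁰ > 0`. The latter is the
time-vector analogue of `clockMap_carter_timeRaising` (…RechartCarterTimeRaising):
* `clockMap_timeRaising_short` — for SHORT vectors `w` (`1 ≤ w⁰ ≤ 3`, `‖w̃‖ ≤ w⁰ − 1`), eventually in
  the chart time, on `{‖ỹ‖ ≤ K}`, `DT(y) w ≥ 1/2` (`DT w = ũ⁰(1 + ℓ'ỹ)w⁰ + ℓ(w̃)`,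
  `|ℓ(w̃)| ≤ √(ũ⁰² − 1)‖w̃‖ ≤ ũ⁰(w⁰ − 1)`, `|ℓ'ỹ| ≤ 1/6`);
* `norm_spatial_timeVector_le`, `scalarH_le_one_of_le_radius`, `timeVector_short` — the
  Kerr–Schild time vector is short on the exterior (`V⁰ = 1 + 2H` is
  `Kerr.timeVector_apply_zero`, `‖Ṽ‖ = 2H`, `0 ≤ H ≤ M/r ≤ 1`);
* `eventually_isFutureDirected_lagClockChart` — clause (ii) for the lagged boosted clock chart
  `y ↦ Φ(A(Λ⁻¹ y))` on `boostedKerrBackground Λ (s • Λe₀) M a`.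
[Dafermos–Rodnianski arXiv:0811.0354, §5.1; O'Neill 1983, Ch. 5, p. 145; folklore]
-/

noncomputable section

set_option linter.dupNamespace false

open Set Filter Topology Function TopologicalSpace Literature.Geometry.Lorentzian
open Summit.FinalStateConjecture.FinalStateConjecture.Theorems.SublinearIsFree.Rechart
open scoped Manifold ContDiff ENNReal

namespace Summit.FinalStateConjecture.FinalStateConjecture.Theorems

/-! ### The Kerr–Schild time vector is short -/

/-- `ℓ♯⁰ = −1`. [cite: KerrSchild1965, §2] -/
theorem nullVector_apply_zero_eq (a : ℝ) (x : E4) : Kerr.nullVector a x 0 = -1 := by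
  simp [Kerr.nullVector, Kerr.nullCovectorFun]

/-- `‖ℓ⃗♯‖ = 1` wherever `r > 0` (`ℓ` is `η`-null and `ℓ♯⁰ = −1`). [cite: KerrSchild1965, §2] -/
theorem spatialNorm_nullVector_eq_one (a : ℝ) {x : E4} (hx : 0 < Kerr.radius a x) :
    E4.spatialNorm (Kerr.nullVector a x) = 1 := by
  have h := Kerr.bilin_nullVector a x (Kerr.nullVector a x)
  rw [Kerr.nullCovector_nullVector hx, minkowski_bilin_self, nullVector_apply_zero_eq] at h
  have h1 : E4.spatialNorm (Kerr.nullVector a x) ^ 2 = 1 := by linarith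
  have h0 : 0 ≤ E4.spatialNorm (Kerr.nullVector a x) := E4.spatialNorm_nonneg _
  nlinarith

/-- `‖Ṽ‖ ≤ 2H` (indeed `= 2H`) for the Kerr–Schild time vector, `M ≥ 0`, `r > 0`.
[cite: arXiv08110354, §5.1] -/
theorem norm_spatial_timeVector_le {M : ℝ} (hM : 0 ≤ M) (a : ℝ) {x : E4} (hx : 0 < Kerr.radius a x) :
    ‖E4.spatial (Kerr.timeVector M a x)‖ ≤ 2 * Kerr.scalarH M a x := by
  have hH := Kerr.scalarH_nonneg hM a x
  rw [Kerr.timeVector, map_sub, map_smul, spatial_basisVector_zero, zero_sub, norm_neg, norm_smul,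
    Real.norm_eq_abs, abs_of_nonneg (by positivity)]
  have h1 : ‖E4.spatial (Kerr.nullVector a x)‖ = 1 := spatialNorm_nullVector_eq_one a hx
  rw [h1, mul_one]

/-- `H ≤ 1` at points with `r ≥ M ≥ 0`, `r > 0` (`H = Mr³/(r⁴ + a²z²) ≤ M/r`). [cite: arXiv07060622, (33)] -/
theorem scalarH_le_one_of_le_radius (M a : ℝ) {x : E4} (hx : 0 < Kerr.radius a x)
    (hMr : M ≤ Kerr.radius a x) : Kerr.scalarH M a x ≤ 1 := by
  unfold Kerr.scalarH
  set r := Kerr.radius a x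
  have hden : 0 < r ^ 4 + a ^ 2 * x 3 ^ 2 := by positivity
  rw [div_le_one hden]
  have h1 : M * r ^ 3 ≤ r * r ^ 3 := mul_le_mul_of_nonneg_right hMr (by positivity)
  nlinarith [sq_nonneg (a * x 3)]

/-- On the Kerr exterior of a subextremal hole the time vector is short: `1 ≤ V⁰ ≤ 3`,
`‖Ṽ‖ ≤ V⁰ − 1`, and `‖V‖² ≤ 13`. [folklore] -/
theorem timeVector_short {M a : ℝ} (hsub : Kerr.IsSubextremal M a) {x : E4}
    (hx : x ∈ Kerr.exterior M a) :
    1 ≤ Kerr.timeVector M a x 0 ∧ Kerr.timeVector M a x 0 ≤ 3 ∧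
      ‖E4.spatial (Kerr.timeVector M a x)‖ ≤ Kerr.timeVector M a x 0 - 1 ∧
      ‖Kerr.timeVector M a x‖ ^ 2 ≤ 13 := by
  have hM : 0 < M := hsub.pos
  rw [Kerr.mem_exterior] at hx
  have hrp : Kerr.rPlus M a < Kerr.radius a x := (le_max_left _ _).trans_lt hx
  have hMr : M ≤ Kerr.rPlus M a := by
    unfold Kerr.rPlus; linarith [Real.sqrt_nonneg (M ^ 2 - a ^ 2)]
  have hr : 0 < Kerr.radius a x := hM.trans_le (hMr.trans hrp.le)
  have hH0 := Kerr.scalarH_nonneg hM.le a x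
  have hH1 := scalarH_le_one_of_le_radius M a hr (hMr.trans hrp.le)
  have h0 := Kerr.timeVector_apply_zero M a x
  have hsp := norm_spatial_timeVector_le hM.le a hr
  refine ⟨by rw [h0]; linarith, by rw [h0]; linarith, by rw [h0]; linarith, ?_⟩
  have hn := norm_sq_eq_sq_add_spatialNorm_sq (Kerr.timeVector M a x)
  have hs : E4.spatialNorm (Kerr.timeVector M a x) = ‖E4.spatial (Kerr.timeVector M a x)‖ := rfl
  rw [hn, hs, h0]
  nlinarith [norm_nonneg (E4.spatial (Kerr.timeVector M a x))]

/-! ### Lab time rises along short vectors -/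

section TimeRaising

variable (Λ : ℝ → lorentzGroup) (ξ : ℝ → E3) (T₀ : ℝ → ℝ)
  (hΛ : ContDiff ℝ ∞ (fun t ↦ ((Λ t : E4 ≃L[ℝ] E4) : E4 →L[ℝ] E4)))
  (hξ : ContDiff ℝ ∞ ξ) (hT₀ : ContDiff ℝ ∞ T₀)

include hΛ hT₀ in
/-- **The clock map raises lab time along short vectors, uniformly.** For an orthochronous frame
`Λ̃(t)` with slaved tilt rate `(frameTilt ∘ Λ̃)' → 0` and the proper-time clock `T₀`
(`T₀' = ũ⁰ ∘ Λ̃ ∘ T₀`, `T₀ → ∞`): for every `K ≥ 0`, eventually in the chart time `y⁰`, at every rest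
point `y` with `‖ỹ‖ ≤ K` and for every `w` with `1 ≤ w⁰ ≤ 3`, `‖w̃‖ ≤ w⁰ − 1`: `DT(y) w ≥ 1/2`.
[folklore] -/
theorem clockMap_timeRaising_short (hclock : ∀ τ, deriv T₀ τ = frameVel (Λ (T₀ τ)) 0)
    (hpos : ∀ t, 0 < frameVel (Λ t) 0)
    (hdec : Tendsto (fun t ↦ deriv (fun s ↦ frameTilt (Λ s)) t) atTop (𝓝 0))
    (htop : Tendsto T₀ atTop atTop) {K : ℝ} (hK : 0 ≤ K) :
    ∃ τK : ℝ, ∀ y : E4, τK ≤ y 0 → ‖E4.spatial y‖ ≤ K → ∀ w : E4, 1 ≤ w 0 → w 0 ≤ 3 →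
      ‖E4.spatial w‖ ≤ w 0 - 1 → 1 / 2 ≤ fderiv ℝ (clockMap Λ T₀) y w := by
  -- thresholds: small tilt rate after `T₁`, clock beyond `T₁` after `τK`
  have hε : (0 : ℝ) < 1 / (6 * (K + 1)) := by positivity
  obtain ⟨T₁, hT₁⟩ := (Metric.tendsto_atTop.mp hdec) _ hε
  obtain ⟨τK, hτK⟩ := eventually_atTop.1 (tendsto_atTop.1 htop T₁)
  refine ⟨τK, fun y hy hyK w hw1 hw3 hws ↦ ?_⟩
  set t : ℝ := T₀ (y 0) with ht
  have htT : T₁ ≤ t := hτK _ hy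
  have hD := (hasFDerivAt_clockMap Λ T₀ hΛ hT₀ y).fderiv
  rw [hD]
  simp only [add_apply, FunLike.coe_smul, Pi.smul_apply,
    ContinuousLinearMap.coe_comp, comp_apply, smul_eq_mul, PiLp.proj_apply]
  -- the clock rate
  set u0 : ℝ := frameVel (Λ t) 0 with hu0
  have hu01 : 1 ≤ u0 := by
    have h1 := one_le_abs_lorentz_apply_zero (Λ t)
    have h2 : 0 < u0 := hpos t
    rw [hu0, frameVel] at h2 ⊢
    rwa [abs_of_pos h2] at h1
  have hclk : deriv T₀ (y 0) = u0 := by rw [hclock, ← ht]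
  -- the slaved tilt-rate term
  have hd : |deriv (fun s ↦ frameTilt (Λ s)) t (E4.spatial y)| ≤ 1 / 6 := by
    have h1 : ‖deriv (fun s ↦ frameTilt (Λ s)) t‖ ≤ 1 / (6 * (K + 1)) := by
      have := hT₁ t htT
      rw [dist_zero_right] at this
      exact this.le
    have h2 := (deriv (fun s ↦ frameTilt (Λ s)) t).le_opNorm (E4.spatial y)
    rw [Real.norm_eq_abs] at h2
    calc |deriv (fun s ↦ frameTilt (Λ s)) t (E4.spatial y)|
        ≤ ‖deriv (fun s ↦ frameTilt (Λ s)) t‖ * ‖E4.spatial y‖ := h2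
      _ ≤ 1 / (6 * (K + 1)) * K := mul_le_mul h1 hyK (norm_nonneg _) (by positivity)
      _ ≤ 1 / 6 := by
          rw [div_mul_eq_mul_div, div_le_div_iff₀ (by positivity) (by norm_num)]
          nlinarith
  -- the tilt term on the short spatial part of `w`
  have htilt : |frameTilt (Λ t) (E4.spatial w)| ≤ u0 * (w 0 - 1) := by
    have h1 := abs_frameTilt_le (Λ t) (E4.spatial w)
    have h2 : Real.sqrt ((((Λ t : E4 ≃L[ℝ] E4) (E4.basisVector 0)) 0) ^ 2 - 1) ≤ u0 :=
      sqrt_sq_sub_one_le (by rw [hu0, frameVel] at hu01; exact zero_le_one.trans (by exact hu01))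
    exact h1.trans (mul_le_mul h2 hws (norm_nonneg _) (zero_le_one.trans hu01))
  rw [hclk]
  set d := deriv (fun s ↦ frameTilt (Λ s)) t (E4.spatial y) with hdd
  set f := frameTilt (Λ t) (E4.spatial w) with hf
  have h1 := (abs_le.mp hd).1
  have h2 := (abs_le.mp htilt).1
  have h3 : 0 ≤ (d + 1 / 6) * (u0 * w 0) := mul_nonneg (by linarith) (by nlinarith)
  have h4 : u0 * w 0 ≤ u0 * 3 := mul_le_mul_of_nonneg_left hw3 (by linarith)
  nlinarith

include hΛ hξ hT₀ in
/-- **A re-charting map that is the honest chart near late points of bounded offset raises lab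
time along short vectors**, uniformly on `{‖ỹ‖ ≤ K}` eventually in `y⁰`. [folklore] -/
theorem rechartMap_timeRaising_short (hclock : ∀ τ, deriv T₀ τ = frameVel (Λ (T₀ τ)) 0)
    (hpos : ∀ t, 0 < frameVel (Λ t) 0)
    (hdec : Tendsto (fun t ↦ deriv (fun s ↦ frameTilt (Λ s)) t) atTop (𝓝 0))
    (htop : Tendsto T₀ atTop atTop) {A : E4 → E4}
    (hhon : ∀ K : ℝ, ∃ τK : ℝ, ∀ y : E4, τK ≤ y 0 → ‖E4.spatial y‖ ≤ K →
      A =ᶠ[𝓝 y] honestChart Λ ξ T₀) {K : ℝ} (hK : 0 ≤ K) :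
    ∃ τK : ℝ, ∀ y : E4, τK ≤ y 0 → ‖E4.spatial y‖ ≤ K → ∀ w : E4, 1 ≤ w 0 → w 0 ≤ 3 →
      ‖E4.spatial w‖ ≤ w 0 - 1 → 1 / 2 ≤ (fderiv ℝ A y w) 0 := by
  obtain ⟨τ₁, h₁⟩ := clockMap_timeRaising_short Λ T₀ hΛ hT₀ hclock hpos hdec htop hK
  obtain ⟨τ₂, h₂⟩ := hhon K
  refine ⟨max τ₁ τ₂, fun y hy hyK w hw1 hw3 hws ↦ ?_⟩
  rw [(h₂ y ((le_max_right _ _).trans hy) hyK).fderiv_eq,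
    fderiv_honestChart_apply_zero Λ ξ T₀ hΛ hξ hT₀]
  exact h₁ y ((le_max_left _ _).trans hy) hyK w hw1 hw3 hws

end TimeRaising

/-! ### Clause (ii) for the lagged boosted clock chart -/

section Lag

variable {𝓢 : Spacetime 4} (U : Opens E4) (Φ : U → 𝓢.carrier) (Q : U → Prop)
  (hΦ : ContMDiff 𝓘(ℝ, E4) (𝓡 4) ∞ Φ)
  (hOfut : ∀ x : U, Q x → ∀ w : E4, 0 < w 0 →
    𝓢.metric.val (Φ x) (mfderiv 𝓘(ℝ, E4) (𝓡 4) Φ x w) (mfderiv 𝓘(ℝ, E4) (𝓡 4) Φ x w) < 0 →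
      𝓢.timeOrientation.IsFutureDirected (mfderiv 𝓘(ℝ, E4) (𝓡 4) Φ x w))
  (Λf : lorentzGroup) (s : ℝ) {M a : ℝ} (hsub : Kerr.IsSubextremal M a)
  (Λ : ℝ → lorentzGroup) (ξ : ℝ → E3) (T₀ : ℝ → ℝ)
  (hΛ : ContDiff ℝ ∞ (fun t ↦ ((Λ t : E4 ≃L[ℝ] E4) : E4 →L[ℝ] E4)))
  (hξ : ContDiff ℝ ∞ ξ) (hT₀ : ContDiff ℝ ∞ T₀)
  (hclock : ∀ τ, deriv T₀ τ = frameVel (Λ (T₀ τ)) 0) (hpos : ∀ t, 0 < frameVel (Λ t) 0)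
  (hdec : Tendsto (fun t ↦ deriv (fun s ↦ frameTilt (Λ s)) t) atTop (𝓝 0))
  (htop : Tendsto T₀ atTop atTop) {A : E4 → E4} (hA : ContDiff ℝ ∞ A)
  (hhon : ∀ K : ℝ, ∃ τK : ℝ, ∀ y : E4, τK ≤ y 0 → ‖E4.spatial y‖ ≤ K →
    A =ᶠ[𝓝 y] honestChart Λ ξ T₀)
  (hAU : ∀ y ∈ (boostedKerrBackground Λf (s • (Λf : E4 ≃L[ℝ] E4) (E4.basisVector 0)) M a).domain,
    A ((Λf : E4 ≃L[ℝ] E4).symm y) ∈ U)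
  (hQA : ∀ y : (boostedKerrBackground Λf (s • (Λf : E4 ≃L[ℝ] E4) (E4.basisVector 0)) M a).domain,
    Q ⟨A ((Λf : E4 ≃L[ℝ] E4).symm y.1), hAU y.1 y.2⟩)
  {k : ℕ} {R : ℝ → ℝ} (hRt : Tendsto R atTop atTop)
  (hconv : Tendsto (fun τ ↦ 𝓢.truncDeviationCk
    (boostedKerrBackground Λf (s • (Λf : E4 ≃L[ℝ] E4) (E4.basisVector 0)) M a)
    (fun y ↦ Φ ⟨A ((Λf : E4 ≃L[ℝ] E4).symm y.1), hAU y.1 y.2⟩) k (R τ) τ) atTop (𝓝 0))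

include hΦ hOfut hsub hΛ hξ hT₀ hclock hpos hdec htop hA hhon hQA hRt hconv in
/-- **The lagged boosted clock chart is eventually future-oriented** (clause (ii) of
`IsFutureOriented`): for every `ρ`, eventually in the chart time `τ`, on the truncated slab
`{t* = τ, r ≤ ρ}` of `boostedKerrBackground Λ (s • Λe₀) M a` the push-forward under
`y ↦ Φ(A(Λ⁻¹y))` of `Λ V_{M,a}(Λ⁻¹(y − sΛe₀))` is future-directed: the model value is
`g_{M,a}(V, V) = −1 − 2H ≤ −1`, the `C⁰` deviation is eventually small on the slab, the chart raises
lab time along `V` (`rechartMap_timeRaising_short` at the rest point `Λ⁻¹y`, late and of bounded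
offset on the slab), and (Ofut) fixes the sign. [folklore] -/
theorem eventually_isFutureDirected_lagClockChart (ρ : ℝ) :
    ∀ᶠ τ in atTop, ∀ y ∈ (boostedKerrBackground Λf (s • (Λf : E4 ≃L[ℝ] E4) (E4.basisVector 0)) M a).truncTimeSlab ρ τ,
      𝓢.timeOrientation.IsFutureDirected (mfderiv 𝓘(ℝ, E4) (𝓡 4)
        (fun y : (boostedKerrBackground Λf (s • (Λf : E4 ≃L[ℝ] E4) (E4.basisVector 0)) M a).domain ↦
          Φ ⟨A ((Λf : E4 ≃L[ℝ] E4).symm y.1), hAU y.1 y.2⟩) y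
        ((Λf : E4 ≃L[ℝ] E4) (Kerr.timeVector M a
          (poincareInv Λf (s • (Λf : E4 ≃L[ℝ] E4) (E4.basisVector 0)) (y : E4))))) := by
  set Kb := boostedKerrBackground Λf (s • (Λf : E4 ≃L[ℝ] E4) (E4.basisVector 0)) M a with hKb
  set A' : E4 → E4 := fun z ↦ A ((Λf : E4 ≃L[ℝ] E4).symm z) with hA'
  have hA'c : ContDiff ℝ ∞ A' := hA.comp (Λf : E4 ≃L[ℝ] E4).symm.contDiff
  have hM : 0 < M := hsub.pos
  -- size of `u = Λ V`: `‖u‖² ≤ 13 ‖Λ‖²`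
  set K₁ : ℝ := 13 * ‖((Λf : E4 ≃L[ℝ] E4) : E4 →L[ℝ] E4)‖ ^ 2 with hK₁
  set c₀ : ℝ := 1 / (2 * (K₁ + 1)) with hc₀
  have hK₁0 : 0 ≤ K₁ := by positivity
  have hc₀pos : 0 < c₀ := by positivity
  have hc₀K : c₀ * K₁ < 1 := by
    rw [hc₀, div_mul_eq_mul_div, one_mul, div_lt_one (by positivity)]; linarith
  -- thresholds
  set K : ℝ := max ρ 0 + |a| with hK
  have hK0 : 0 ≤ K := by positivity
  obtain ⟨τK, hτK⟩ := rechartMap_timeRaising_short Λ ξ T₀ hΛ hξ hT₀ hclock hpos hdec htop hhon hK0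
  have h1 : ∀ᶠ τ in atTop, 𝓢.truncDeviationCk Kb (fun y ↦ Φ ⟨A' y.1, hAU y.1 y.2⟩) k (R τ) τ ≤
      ENNReal.ofReal c₀ := ENNReal.tendsto_nhds_zero.1 hconv _ (ENNReal.ofReal_pos.2 hc₀pos)
  have h2 : ∀ᶠ τ in atTop, ρ ≤ R τ := hRt.eventually (eventually_ge_atTop ρ)
  filter_upwards [h1, h2, eventually_ge_atTop (τK - s)] with τ hτ hρ hτs y hy
  obtain ⟨hyt, hyr⟩ := hy
  -- the rest point and the model point
  set z : E4 := (Λf : E4 ≃L[ℝ] E4).symm y.1 with hz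
  have hpi : poincareInv Λf (s • (Λf : E4 ≃L[ℝ] E4) (E4.basisVector 0)) y.1 = z - s • E4.basisVector 0 :=
    poincareInv_lag Λf s y.1
  set z' : E4 := z - s • E4.basisVector 0 with hz'
  have hz'ext : z' ∈ Kerr.exterior M a := by
    have hy2 := y.2
    change y.1 ∈ boostedKerrExterior Λf (s • (Λf : E4 ≃L[ℝ] E4) (E4.basisVector 0)) M a at hy2
    rw [mem_boostedKerrExterior, hpi] at hy2
    exact hy2
  have hrad : 0 < Kerr.radius a z' := by
    have h := hz'ext
    rw [Kerr.mem_exterior] at h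
    exact (le_max_right _ _).trans_lt h
  obtain ⟨hV1, hV3, hVs, hV13⟩ := timeVector_short hsub hz'ext
  set V : E4 := Kerr.timeVector M a z' with hV
  -- lateness and offset of the rest point on the slab
  have hz0 : z 0 = τ + s := by
    have h := hyt
    rw [lag_time] at h
    rw [hz]; linarith
  have hzK : ‖E4.spatial z‖ ≤ K := by
    have h := hyr
    change Kerr.radius a (poincareInv Λf (s • (Λf : E4 ≃L[ℝ] E4) (E4.basisVector 0)) y.1) ≤ ρ at h
    rw [hpi] at h
    have h' := norm_spatial_le_of_radius_le a z' h
    rwa [hz', spatial_sub_smul_basisVector_zero] at h'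
  -- lab-time raising along `V`
  have hA0 : 0 < (fderiv ℝ A' y.1 ((Λf : E4 ≃L[ℝ] E4) V)) 0 := by
    have hcomp : fderiv ℝ A' y.1 = (fderiv ℝ A z).comp (((Λf : E4 ≃L[ℝ] E4).symm : E4 →L[ℝ] E4)) := by
      have hd : HasFDerivAt A (fderiv ℝ A z) ((Λf : E4 ≃L[ℝ] E4).symm y.1) :=
        ((hA.differentiable (by simp)) _).hasFDerivAt
      exact (hd.comp y.1 (Λf : E4 ≃L[ℝ] E4).symm.hasFDerivAt).fderiv
    rw [hcomp, ContinuousLinearMap.comp_apply, ContinuousLinearEquiv.coe_coe,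
      ContinuousLinearEquiv.symm_apply_apply]
    have h := hτK z (by rw [hz0]; linarith) hzK V hV1 hV3 hVs
    linarith
  -- the model value along `u`
  have hbil : Kb.bilin y.1 ((Λf : E4 ≃L[ℝ] E4) V) ((Λf : E4 ≃L[ℝ] E4) V) ≤ -1 := by
    show boostedKerrBilin Λf (s • (Λf : E4 ≃L[ℝ] E4) (E4.basisVector 0)) M a y.1 _ _ ≤ -1
    rw [boostedKerrBilin_apply, ContinuousLinearEquiv.symm_apply_apply, hpi,
      Kerr.bilin_timeVector_timeVector hrad]
    linarith [Kerr.scalarH_nonneg hM.le a z']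
  have hnorm : ‖(Λf : E4 ≃L[ℝ] E4) V‖ ^ 2 ≤ K₁ := by
    have h1 : ‖(Λf : E4 ≃L[ℝ] E4) V‖ ≤ ‖((Λf : E4 ≃L[ℝ] E4) : E4 →L[ℝ] E4)‖ * ‖V‖ :=
      ((Λf : E4 ≃L[ℝ] E4) : E4 →L[ℝ] E4).le_opNorm V
    have h2 : ‖(Λf : E4 ≃L[ℝ] E4) V‖ ^ 2 ≤ (‖((Λf : E4 ≃L[ℝ] E4) : E4 →L[ℝ] E4)‖ * ‖V‖) ^ 2 :=
      pow_le_pow_left₀ (norm_nonneg _) h1 2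
    rw [hK₁]
    nlinarith [norm_nonneg (((Λf : E4 ≃L[ℝ] E4) : E4 →L[ℝ] E4)), sq_nonneg ‖((Λf : E4 ≃L[ℝ] E4) : E4 →L[ℝ] E4)‖]
  have hcK : c₀ * ‖(Λf : E4 ≃L[ℝ] E4) V‖ ^ 2 < 1 :=
    lt_of_le_of_lt (mul_le_mul_of_nonneg_left hnorm hc₀pos.le) hc₀K
  -- the deviation at `y` is at most `c₀`
  have hdev : ‖𝓢.deviation Kb (fun y ↦ Φ ⟨A' y.1, hAU y.1 y.2⟩) y‖ ≤ c₀ := by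
    refine norm_deviation_le_of_truncDeviationCk 𝓢 Kb (fun y ↦ Φ ⟨A' y.1, hAU y.1 y.2⟩) k
      (R := R τ) hc₀pos.le y (hyr.trans hρ) ?_
    rw [hyt]; exact hτ
  have h := isFutureDirected_mfderiv_comp_of_deviation Kb U Φ hΦ hA'c hAU Q hOfut y
    ((Λf : E4 ≃L[ℝ] E4) V) (hQA y) hA0 (m := 1) hbil hcK hdev
  rw [hpi]
  exact h

end Lag

/-- Registered one-line form (carrier `timeVector_apply_zero_rechart12` of the crux item) of
`Kerr.timeVector_apply_zero` (Dafermos–Rodnianski arXiv:0811.0354, §5.1). [cite: arXiv08110354, §5.1] -/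
theorem timeVector_apply_zero_rechart12 : open Literature.Geometry.Lorentzian in ∀ (M a : ℝ) (x : E4), Kerr.timeVector M a x 0 = 1 + 2 * Kerr.scalarH M a x :=
  fun M a x ↦ Kerr.timeVector_apply_zero M a x

end Summit.FinalStateConjecture.FinalStateConjecture.Theorems

end
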